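import Summits.AtomisticToContinuum.BoseEinsteinCondensation.Theorems.LatticeODLROOffHalfFilling.Negative.SaturationBoundaryLemmas

/-!
# Crux `LatticeODLROOffHalfFilling` — off half filling is forced, part A: symmetry and the pigeonhole

Crux-disprover support for `stmt-AtomisticToContinuum-11033` (route BECGroundStateSOS), part 5a
(parts 1–4: `SaturationCertificate`, `SaturationNoLRO`, `SaturationBoundaryLemmas`,
`SaturationBoundary`; parts 5b, 5c: `OffHalfFillingCommutators`, `OffHalfFillingForced`):

* `onSite_mul_totalSpin`, `totalSpin_two_mul_E`, `totalSpin_two_mul_sumE` — `S³_tot S⁺ = S⁺(S³_tot + 1)`;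
* `commute_hop_totalSpin_two` — `U(1)` invariance of the XY bond, `[hop_{xy}, S³_tot] = 0`;
* `totalSpin_two_mulVec_single` — basis configurations are `S³_tot`-eigenvectors
  (`S³_tot|σ⟩ = (|Λ|/2 − #↓σ)|σ⟩`);
* `trace_groundProj_mul_eq_sum`, `exists_col_quad_ge` — `tr(P₀T) = Σ_σ⟨P₀e_σ, TP₀e_σ⟩` and the
  pigeonhole: `c ≤ Re ω_A(T)` gives a nonzero column `ψ = P₀e_σ` with `c‖ψ‖² ≤ Re⟨ψ,Tψ⟩`.
All [folklore].
-/

noncomputable section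

namespace Summit.AtomisticToContinuum.BoseEinsteinCondensation.Theorems.LatticeODLROOffHalfFilling.Negative

open Literature.MathematicalPhysics.QuantumLattice Literature.Probability.LatticeModels Matrix Finset
open scoped ComplexOrder BigOperators

/-! ### Off half filling is FORCED: at `μ ≠ 0` no ground state of `H_{L,μ}` is half filled (large even `L`) -/

section OffHalf

variable {Λ : Type*} [Fintype Λ] [DecidableEq Λ]

/-- `a_x Ŝ^b_tot = Ŝ^b_tot a_x + ([a, Ŝ^b])_x` for any single-site matrix `a`
(cf. `siteSpin_mul_totalSpin`). [folklore] -/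
theorem onSite_mul_totalSpin (x : Λ) (a : Matrix (Fin 2) (Fin 2) ℂ) (b : Fin 3) :
    (onSite x a * totalSpin 1 b : Op Λ 2) = totalSpin 1 b * onSite x a + onSite x ⁅a, spinVec 1 b⁆ := by
  have key : ∀ z : Λ, (onSite x a * siteSpin 1 z b : Op Λ 2) =
      siteSpin 1 z b * onSite x a + if z = x then onSite x ⁅a, spinVec 1 b⁆ else 0 := by
    intro z
    by_cases hz : z = x
    · subst hz
      rw [if_pos rfl]
      simp only [siteSpin]
      rw [onSite_mul, onSite_mul, ← onSite_add', Ring.lie_def]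
      congr 1
      abel
    · rw [if_neg hz, add_zero]
      exact onSite_mul_onSite_comm (Ne.symm hz) _ _
  calc (onSite x a * totalSpin 1 b : Op Λ 2)
      = ∑ z, onSite x a * siteSpin 1 z b := by rw [totalSpin, Finset.mul_sum]
    _ = ∑ z, (siteSpin 1 z b * onSite x a +
          if z = x then onSite x ⁅a, spinVec 1 b⁆ else 0) :=
        Finset.sum_congr rfl fun z _ => key z
    _ = totalSpin 1 b * onSite x a + onSite x ⁅a, spinVec 1 b⁆ := by
        rw [Finset.sum_add_distrib, Finset.sum_ite_eq', if_pos (Finset.mem_univ x), totalSpin,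
          Finset.sum_mul]

/-- `[e, S³] = −e` (raising lowers `S³`-weight bookkeeping: `S³ e = e (S³ + 1)`). [folklore] -/
theorem lie_raise_spinVec_two : ⁅raise, spinVec 1 2⁆ = -raise := by
  have hZ : spinVec 1 2 = !![(1 / 2 : ℂ), 0; 0, -(1 / 2)] := by
    rw [spinVec_two]
    ext i j
    fin_cases i <;> fin_cases j <;> norm_num [SpinOperators.spinZ, Matrix.diagonal_apply]
  rw [Ring.lie_def, hZ]
  ext i j
  fin_cases i <;> fin_cases j <;> norm_num [raise, Matrix.mul_apply, Fin.sum_univ_two]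

/-- `S³_tot S⁺_x = S⁺_x (S³_tot + 1)`. [folklore] -/
theorem totalSpin_two_mul_E (x : Λ) :
    (totalSpin 1 2 : Op Λ 2) * E x = E x * totalSpin 1 2 + E x := by
  have h := onSite_mul_totalSpin x raise 2
  rw [lie_raise_spinVec_two, onSite_neg'] at h
  change E x * totalSpin 1 2 = totalSpin 1 2 * E x + -E x at h
  rw [h]
  abel

/-- `S³_tot S⁺_tot = S⁺_tot (S³_tot + 1)`. [folklore] -/
theorem totalSpin_two_mul_sumE :
    (totalSpin 1 2 : Op Λ 2) * ∑ x : Λ, E x = (∑ x : Λ, E x) * totalSpin 1 2 + ∑ x : Λ, E x := by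
  rw [Finset.mul_sum, Finset.sum_mul, ← Finset.sum_add_distrib]
  exact Finset.sum_congr rfl fun x _ => totalSpin_two_mul_E x

/-- `[S³_x, S³_tot] = 0`. [folklore] -/
theorem commute_siteSpin_two_totalSpin_two (x : Λ) :
    Commute (siteSpin 1 x 2) (totalSpin 1 2 : Op Λ 2) := by
  have h := siteSpin_mul_totalSpin_sub 1 x (2 : Fin 3) 2
  rw [Ring.lie_def, sub_self, onSite_zero] at h
  exact sub_eq_zero.mp h

/-- **`U(1)` invariance of the XY bond**: `[S¹_xS¹_y + S²_xS²_y, S³_tot] = 0`. [folklore] -/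
theorem commute_hop_totalSpin_two (x y : Λ) : Commute (hop x y) (totalSpin 1 2 : Op Λ 2) := by
  have h3 := commute_sum_siteSpin_mul_siteSpin_totalSpin 1 x y 2
  have heq : hop x y = (∑ α : Fin 3, siteSpin 1 x α * siteSpin 1 y α) -
      siteSpin 1 x 2 * siteSpin 1 y 2 := by
    rw [Fin.sum_univ_three, hop]
    abel
  rw [heq]
  exact h3.sub_left ((commute_siteSpin_two_totalSpin_two x).mul_left
    (commute_siteSpin_two_totalSpin_two y))

/-- Entries of `P↓_x w`: diagonal, `[σ_x = ↓] w(σ)`. [folklore] -/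
theorem Pd_mulVec_apply (x : Λ) (w : TensorIndex Λ 2 → ℂ) (σ : TensorIndex Λ 2) :
    (Pd x *ᵥ w) σ = if σ x = 1 then w σ else 0 := by
  rw [Pd, LiebMattis.onSite_mulVec_apply, Fin.sum_univ_two]
  by_cases hσ : σ x = 1
  · rw [if_pos hσ, hσ]
    have h10 : pDown 1 0 = 0 := by simp [pDown]
    have h11 : pDown 1 1 = 1 := by simp [pDown]
    rw [h10, h11, zero_mul, zero_add, one_mul, ← hσ, Function.update_eq_self]
  · have h0 : σ x = 0 := by
      rcases Fin.exists_fin_two.mp ⟨σ x, rfl⟩ with h | h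
      · exact h
      · exact absurd h hσ
    rw [if_neg hσ, h0]
    have h00 : pDown 0 0 = 0 := by simp [pDown]
    have h01 : pDown 0 1 = 0 := by simp [pDown]
    rw [h00, h01, zero_mul, zero_mul, add_zero]

/-- The number of down spins of a configuration. [folklore] -/
def downCount (σ : TensorIndex Λ 2) : ℕ := (Finset.univ.filter fun x : Λ => σ x = 1).card

/-- `N↓ |σ⟩ = (#↓ σ) |σ⟩`. [folklore] -/
theorem sum_Pd_mulVec_single (σ : TensorIndex Λ 2) :
    (∑ x : Λ, Pd x) *ᵥ (Pi.single σ (1 : ℂ)) = (downCount σ : ℂ) • Pi.single σ 1 := by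
  rw [Matrix.sum_mulVec]
  have h : ∀ x : Λ, Pd x *ᵥ (Pi.single σ (1 : ℂ)) = if σ x = 1 then Pi.single σ 1 else 0 := by
    intro x
    ext τ
    rw [Pd_mulVec_apply]
    by_cases hτ : τ = σ
    · subst hτ
      split_ifs <;> simp
    · have h0 : (Pi.single σ (1 : ℂ) : TensorIndex Λ 2 → ℂ) τ = 0 := by
        simp [hτ]
      rw [h0]
      split_ifs <;> first | rfl | rw [h0]
  rw [Finset.sum_congr rfl fun x _ => h x, Finset.sum_ite, Finset.sum_const_zero, add_zero,
    Finset.sum_const, ← Nat.cast_smul_eq_nsmul ℂ, downCount]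

/-- **Basis configurations are `S³_tot`-eigenvectors**: `S³_tot |σ⟩ = (|Λ|/2 − #↓σ)|σ⟩`.
[folklore] -/
theorem totalSpin_two_mulVec_single (σ : TensorIndex Λ 2) :
    (totalSpin 1 2 : Op Λ 2) *ᵥ Pi.single σ 1 =
      ((Fintype.card Λ : ℂ) / 2 - (downCount σ : ℂ)) • Pi.single σ 1 := by
  rw [totalSpin_two_eq, sub_mulVec, smul_mulVec, one_mulVec, sum_Pd_mulVec_single, sub_smul]

/-- **The trace behind the tracial ground state**: `tr(P₀T) = Σ_σ ⟨P₀e_σ, T P₀e_σ⟩`. [folklore] -/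
theorem trace_groundProj_mul_eq_sum {m : Type*} [Fintype m] [DecidableEq m] (A T : Matrix m m ℂ) :
    (A.groundProj * T).trace = ∑ σ, star (A.groundProj.col σ) ⬝ᵥ T *ᵥ (A.groundProj.col σ) := by
  set P := A.groundProj with hPdef
  have hP : Pᴴ = P := (groundProj_isHermitian A).eq
  have hPP : P * P = P := groundProj_mul_self A
  have h1 : (P * T).trace = (Pᴴ * T * P).trace := by
    rw [hP]
    calc (P * T).trace = (T * P).trace := trace_mul_comm _ _
      _ = (T * (P * P)).trace := by rw [hPP]
      _ = (T * P * P).trace := by rw [Matrix.mul_assoc]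
      _ = (P * (T * P)).trace := trace_mul_comm _ _
      _ = (P * T * P).trace := by rw [Matrix.mul_assoc]
  rw [h1]
  simp only [Matrix.trace, Matrix.diag, Matrix.mul_apply, dotProduct, mulVec, Matrix.col_apply,
    Pi.star_apply, conjTranspose_apply, Finset.sum_mul, Finset.mul_sum]
  refine Finset.sum_congr rfl fun σ _ => ?_
  rw [Finset.sum_comm]
  refine Finset.sum_congr rfl fun a _ => Finset.sum_congr rfl fun b _ => ?_
  ring

/-- The columns of `P₀` are ground vectors. [folklore] -/
theorem groundProj_col_mem {m : Type*} [Fintype m] [DecidableEq m] (A : Matrix m m ℂ) (σ : m) :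
    A.groundProj.col σ ∈ A.groundSpace := by
  rw [← mulVec_single_one]
  exact groundProj_mulVec_mem A _

/-- `star v ⬝ᵥ v` is the real number `Σ|v_i|²`. [folklore] -/
theorem star_dotProduct_self_eq_ofReal {m : Type*} [Fintype m] (v : m → ℂ) :
    star v ⬝ᵥ v = (((star v ⬝ᵥ v).re : ℝ) : ℂ) := by
  obtain ⟨-, him⟩ := Complex.nonneg_iff.mp (dotProduct_star_self_nonneg v)
  exact Complex.ext (by simp) (by simp [← him])

/-- **Pigeonhole in the ground space**: if `c ≤ Re ω_A(T)` then some nonzero column `ψ = P₀e_σ`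
(a ground vector) has `c‖ψ‖² ≤ Re⟨ψ, Tψ⟩`. [folklore] -/
theorem exists_col_quad_ge {m : Type*} [Fintype m] [DecidableEq m] [Nonempty m]
    {A : Matrix m m ℂ} (hA : A.IsHermitian) (T : Matrix m m ℂ) (c : ℝ)
    (h : c ≤ (A.groundStateFunctional T).re) :
    ∃ σ, A.groundProj.col σ ≠ 0 ∧ c * (star (A.groundProj.col σ) ⬝ᵥ A.groundProj.col σ).re ≤
      (star (A.groundProj.col σ) ⬝ᵥ T *ᵥ (A.groundProj.col σ)).re := by
  by_contra hcon
  push Not at hcon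
  set P := A.groundProj with hPdef
  have htrT := trace_groundProj_mul_eq_sum A T
  have htr1 : P.trace = ∑ σ, star (P.col σ) ⬝ᵥ (P.col σ) := by
    have := trace_groundProj_mul_eq_sum A 1
    rw [mul_one] at this
    simpa only [one_mulVec] using this
  have hnn : ∀ σ, 0 ≤ (star (P.col σ) ⬝ᵥ (P.col σ)).re := fun σ =>
    (Complex.nonneg_iff.mp (dotProduct_star_self_nonneg _)).1
  have hle : ∀ σ, (star (P.col σ) ⬝ᵥ T *ᵥ P.col σ).re ≤ c * (star (P.col σ) ⬝ᵥ P.col σ).re := by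
    intro σ
    by_cases h0 : P.col σ = 0
    · simp [h0]
    · exact (hcon σ h0).le
  obtain ⟨σ₀, hσ₀⟩ : ∃ σ, P.col σ ≠ 0 := by
    by_contra hall
    push Not at hall
    have : P.trace = 0 := by
      rw [htr1]
      exact Finset.sum_eq_zero fun σ _ => by simp [hall σ]
    exact (trace_groundProj_ne_zero hA) this
  have hpos₀ : 0 < (star (P.col σ₀) ⬝ᵥ (P.col σ₀)).re := by
    have hne : star (P.col σ₀) ⬝ᵥ (P.col σ₀) ≠ 0 := fun h0 =>
      hσ₀ (dotProduct_star_self_eq_zero.mp h0)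
    have hre := star_dotProduct_self_eq_ofReal (P.col σ₀)
    rcases (hnn σ₀).lt_or_eq with hlt | heq
    · exact hlt
    · exfalso; apply hne; rw [hre, ← heq]; simp
  have hS : 0 < ∑ σ, (star (P.col σ) ⬝ᵥ (P.col σ)).re :=
    Finset.sum_pos' (fun σ _ => hnn σ) ⟨σ₀, Finset.mem_univ _, hpos₀⟩
  have hlt : (∑ σ, (star (P.col σ) ⬝ᵥ T *ᵥ P.col σ).re) <
      ∑ σ, c * (star (P.col σ) ⬝ᵥ P.col σ).re :=
    Finset.sum_lt_sum (fun σ _ => hle σ) ⟨σ₀, Finset.mem_univ _, hcon σ₀ hσ₀⟩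
  rw [← Finset.mul_sum] at hlt
  have hω : (A.groundStateFunctional T).re =
      (∑ σ, (star (P.col σ) ⬝ᵥ T *ᵥ P.col σ).re) / ∑ σ, (star (P.col σ) ⬝ᵥ (P.col σ)).re := by
    rw [groundStateFunctional_apply, ← hPdef, htrT, htr1]
    have hreal : (∑ σ, star (P.col σ) ⬝ᵥ (P.col σ)) =
        (((∑ σ, (star (P.col σ) ⬝ᵥ (P.col σ)).re) : ℝ) : ℂ) := by
      rw [Complex.ofReal_sum]
      exact Finset.sum_congr rfl fun σ _ => star_dotProduct_self_eq_ofReal _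
    rw [hreal, ← Complex.ofReal_inv, Complex.re_ofReal_mul, Complex.re_sum, inv_mul_eq_div]
  rw [hω, le_div_iff₀ hS] at h
  linarith

end OffHalf

end Summit.AtomisticToContinuum.BoseEinsteinCondensation.Theorems.LatticeODLROOffHalfFilling.Negative
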